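import Mathlib
import Literature.NumberTheory.LFunctions.WeilExplicit
import Literature.NumberTheory.LFunctions.RiemannXi
import Literature.Analysis.SpecialFunctions.GammaVerticalBounds
import HarnessLib

/-!
# GammaLowerBound

Topic `Literature/Uncategorized`. Named literature fact(s) relocated by the gate from `Summits/RiemannHypothesis/RiemannHypothesis/Theorems/SpectralTraceHeckeSurrogateDefs.lean`
(accept-time relocation of `[cite]`d propositions written inline in a Summits proposal; human ruling 2026-08-15).
Sources: Titchmarsh1986.

* `Literature.Uncategorized.GammaLowerBound` — PROVED, topical home
  `Literature/Analysis/SpecialFunctions/GammaVerticalLowerBound.lean` (wi-35549)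
* `Literature.Uncategorized.HorizontalLogDerivBound` — PROVED (K = 16), topical home
  `Literature/Analysis/Complex/LogDerivHorizontalSegment.lean` (wi-35550)
-/

namespace Literature.Uncategorized

open Complex Filter Set MeasureTheory
open scoped Real Topology
open Literature.NumberTheory.LFunctions

/-- **Lower bound for the Gamma factor on the lines `Re z = 1/2 + n`**:
`|Γ(1/2 + n + iy)| ≥ √π · e^{-π|y|/2} · 2^{-n}` (reflection formula `|Γ(1/2+iy)|² = π/cosh(πy)`, in the
tree as `Literature.Analysis.SpecialFunctions.GammaVert.norm_sq_Gamma_half`, `cosh(πy) ≤ e^{π|y|}`, and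
`Γ(z+1) = zΓ(z)` with `|1/2 + j + iy| ≥ 1/2`). It is what keeps `log(1/|E(σ₁ + iT)|)` polynomial in `T`
at the centres of the Jensen / Landau discs. PROVED: this is verbatim the statement of the theorem
`Literature.Analysis.SpecialFunctions.GammaVert.norm_Gamma_half_add_nat_add_mul_I_ge`
(`Literature/Analysis/SpecialFunctions/GammaVerticalLowerBound.lean`, its topical home since
librarian refactor wi-35549); discharge record `GammaLowerBound_holds` in
`GammaLowerBoundProofs.lean`. New consumers should use the theorem, not this name.
[folklore] -/
def GammaLowerBound : Prop :=
  ∀ (n : ℕ) (y : ℝ),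
    Real.sqrt π * Real.exp (-(π / 2) * |y|) * (1 / 2) ^ n ≤ ‖Complex.Gamma (1 / 2 + n + y * I)‖

/-- **Landau–Titchmarsh bound for the logarithmic derivative on a horizontal segment** (the shape
consumed on the horizontal sides of the explicit-formula rectangle): there is an absolute `K > 0`
such that for every entire `f`, every centre `c` with `f(c) ≠ 0`, radii `R > 0`, a bound
`‖f‖ ≤ M` on `‖z - c‖ ≤ 2R`, and `η > 0` such that every zero `a` of `f` with `‖a - c‖ ≤ R` has
`|Im a - Im c| ≥ η`, one has `‖f'/f (x + i·Im c)‖ ≤ K (log(M/‖f c‖) + 1)(1/η + 1/R)` for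
`|x - Re c| ≤ R/4` (Titchmarsh §3.9 Lemma α: `f'/f = Σ_{|a-c|≤R} m(a)/(z-a) + O(log(M/|f(c)|)/R)`,
each `|z - a| ≥ η`, and `Σ m(a) ≤ log(M/|f(c)|)/log 2` by Jensen; `K = 16` works). PROVED: with
`K = 16` this is `Literature.Analysis.Complex.norm_logDeriv_ofReal_add_mul_I_le_of_zeros_im_separated`
(`Literature/Analysis/Complex/LogDerivHorizontalSegment.lean`, its topical home since librarian
refactor wi-35550, where the local general-`z` form is the main theorem); discharge record
`HorizontalLogDerivBound_holds` in `HorizontalLogDerivBoundProofs.lean`. New consumers should use the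
theorem, not this name.
[cite: Titchmarsh1986, §3.9 Lemma α] -/
def HorizontalLogDerivBound : Prop :=
  ∃ K : ℝ, 0 < K ∧ ∀ (f : ℂ → ℂ), Differentiable ℂ f →
    ∀ (c : ℂ) (R η M : ℝ), 0 < R → 0 < η → f c ≠ 0 →
      (∀ z ∈ Metric.closedBall c (2 * R), ‖f z‖ ≤ M) →
      (∀ a : ℂ, f a = 0 → ‖a - c‖ ≤ R → η ≤ |a.im - c.im|) →
      ∀ x : ℝ, |x - c.re| ≤ R / 4 →
        ‖logDeriv f (x + c.im * I)‖ ≤ K * (Real.log (M / ‖f c‖) + 1) * (1 / η + 1 / R)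

end Literature.Uncategorized
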